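import Summits.QuantumFields.QCD.Theses.TransparentRPWall
import Summits.QuantumFields.YangMills.Theorems.MirrorModularBoostsCurvatureBoostCovarianceParitySieve
import Literature.MathematicalPhysics.QuantumFieldTheory.OSLorentzInvariance
import Literature.MathematicalPhysics.QuantumFieldTheory.OSReconstructionNoE1

/-!
# Birth skeleton — crux `TransparentRPWall.LabelledBoostSieve` (stmt-QuantumFields-18043)

Piece 2 of the crux-strategist split of `QCDBoostCovariance` (stmt-QuantumFields-9909, route
`route-QuantumFields-TransparentRPWall`, sub `QCD`; planner-cstrat-stmt-QuantumFields-9909-r1-0, 2026-08-17):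
THE MODEL-BLIND SIEVE, ANY LABEL TYPE — for a labelled Schwinger family `S` over any `ι` on `ℝ⁴` with
E0, E0', E2, E3, E4, translation and proper-hypercubic invariance on `⁰𝒮`, reflection positivity in the
eight planar frames and the labelled planar cone: IF every string is `n`-point regular AND the level growth
holds at every level (the two conjuncts of piece 1, `QCDSieveInputs`), THEN every string is invariant on
`⁰𝒮` under the rotations of the `(x₀,x₁)`-plane.

This file is the LABELLED TWIN of the kernel-checked composition `sieve_of_stubs` of the sibling one-species
line `YangMills/Cruxes/CurvatureBoostCovariance/Lines/boosts_inherit_mirrors.lean` (crux 9663), at its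
round-1 granularity.  Currency between the stubs: the ORBIT FUNCTION `θ ↦ 𝔖_{n+m}^{rev k ++ k'}(R_θ · H)` of a
DOUBLED test function `H = ΘF* ⊗ G` (`F`, `G` `e₀`-time-ordered, compactly supported, label strings `k`,
`k'`; `R_θ = planeRot 0 θ`).  Stubs (5 registered `sorry`s + 1 landed theorem by name):

* `stub_cone`             — the labelled cone THEOREM `TransparentRPWall.LabelledPlanarSpectralCone` BY NAME
                             (item stmt-QuantumFields-9910, DERIVED in the route from 18618/18619, candidate
                             sorry-free proofs on file `Cruxes/LabelledPlanarSpectralCone/Proof.lean`): needed a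
                             second time, for the 45° pull-backs (diagonal rays).               provable-now (port)
* `stub_boostVectorsL`     — THE analytic input (4a, labelled, universal at `ι`): uniform planar BOOST VECTORS,
                             holomorphic on a strip, exponential type uniform in the test function — OS II
                             multi-slot continuation WITHOUT E1 along complex-rotation orbits.       XL, model-blind
* `stub_orbitBandlimitL`   — boost vectors + translations + hypercubic + the function residual ⇒ doubled orbit
                             functions are trigonometric polynomials `Σ c_j e^{4ijθ}` (twin of the LANDED
                             `stub_orbitBandlimit(Local)`).                                        L (port)
* `stub_rayPositivityL`    — THE LEVER (i): boosts inherit the mirrors — the 2×2 Laurent pencil of the blocks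
                             `(F,F) (F,G) (G,F) (G,G)` is PSD at every real `s ≠ 0` (axis rays `s > 0`: the
                             `e₀`-reconstruction; diagonal rays `s < 0`: RP at 45° + the cone of the 45°
                             pull-back from `stub_cone`; twin of the LANDED `stub_rayPositivity(Local)`).   L (port)
* `stub_doubledToInvariantL` — doubled-orbit constancy up to level `b` ⇒ invariance in degrees `≤ 2b` (tensor
                             density + a.e. change of variables under the residual; twin of the LANDED
                             `stub_doubledToInvariant` + `stub_tensorDensity`).                     M–L (port)
* the PARITY SIEVE (lever (ii)) is LANDED and label-free: `BoostsInheritMirrors.stub_paritySieve`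
  (`Theorems/MirrorModularBoostsCurvatureBoostCovarianceParitySieve.lean`), used BY NAME.

`LabelledBoostSieve_of` composes them into the crux BY NAME (pure logic: strong induction on the OS level,
the four blocks, parity).  `lean check`: sorries ONLY in the five `stub_*`.
-/

noncomputable section

-- Mathlib's `SimplexCategory` instance `Fintype (Fin (x.len + 1))` matches `Fintype (Fin 4)` (tree-known
-- file-local workaround, as in the sibling's landed files).
attribute [-instance] SimplexCategory.instFintypeToTypeOrderHomFinHAddNatLenOfNat

namespace Summit.QuantumFields.QCD.Cruxes.LabelledBoostSieve.Birth

open scoped BigOperators SchwartzMap InnerProductSpace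
open MeasureTheory Filter Topology
open Literature.MathematicalPhysics.QuantumLattice Literature.MathematicalPhysics.AQFT
  Literature.MathematicalPhysics.QuantumFieldTheory

/-- Euclidean `ℝ⁴`, time = coordinate `0`, the boost plane = coordinates `0, 1`. -/
abbrev E4 : Type := EuclideanSpace ℝ (Fin 4)

/-! ## The labelled predicates (verbatim the clauses of the route decls, `E4` for `E`) -/

variable {ι : Type}

/-- Translation invariance on `⁰𝒮`, all label strings. -/
def TransL (S : LabelledSchwingerFamily ι E4) : Prop :=
  ∀ (n : ℕ) (k : Fin n → ι) (a : E4) (F : SchwartzMap (Fin n → E4) ℂ), IsOffDiagonal F →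
    S n k (translateMulti a F) = S n k F

/-- Invariance on `⁰𝒮` under the proper signed permutations `W(B₄) ∩ SO(4)`. -/
def HypL (S : LabelledSchwingerFamily ι E4) : Prop :=
  ∀ (n : ℕ) (k : Fin n → ι) (R : E4 ≃ₗᵢ[ℝ] E4), LinearMap.det (R.toLinearEquiv : E4 →ₗ[ℝ] E4) = 1 →
    (∀ i : Fin 4, ∃ j : Fin 4, R (EuclideanSpace.single i 1) = EuclideanSpace.single j 1 ∨
      R (EuclideanSpace.single i 1) = -EuclideanSpace.single j 1) →
    ∀ F : SchwartzMap (Fin n → E4) ℂ, IsOffDiagonal F → S n k (linActMulti R F) = S n k F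

/-- Reflection positivity in pull-back form for the EIGHT planar frames. -/
def Frames8 (S : LabelledSchwingerFamily ι E4) : Prop :=
  ∀ (R : E4 ≃ₗᵢ[ℝ] E4) (a b : ℝ), a ^ 2 + b ^ 2 = 1 → (a = 0 ∨ b = 0 ∨ a ^ 2 = b ^ 2) →
    R (EuclideanSpace.single 0 1) = a • EuclideanSpace.single 0 1 + b • EuclideanSpace.single 1 1 →
      LabelledSchwingerFamily.IsReflectionPositive (fun n (k : Fin n → ι) => (S n k).comp (linActMulti R))

/-- The labelled planar spectral cone (verbatim the conclusion of `LabelledPlanarSpectralCone` at `S`). -/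
def ConeL (S : LabelledSchwingerFamily ι E4) : Prop :=
  ∀ (n m : ℕ) (k : Fin n → ι) (k' : Fin m → ι) (F : SchwartzMap (Fin n → E4) ℂ)
    (G : SchwartzMap (Fin m → E4) ℂ), IsTimeOrdered F → IsTimeOrdered G → ∃ Φ : ℂ × ℂ → ℂ,
    DifferentiableOn ℂ Φ {w : ℂ × ℂ | |w.2.im| < w.1.re} ∧ (∀ (t b : ℝ), 0 < t → ∀ H : SchwartzMap
    (Fin (n + m) → E4) ℂ, IsAppendTensorOf H (osAdjoint F) (translateMulti (t • EuclideanSpace.single 0 1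
    + b • EuclideanSpace.single 1 1) G) → Φ ((t : ℂ), (b : ℂ)) = S (n + m) (Fin.append (k ∘ Fin.rev) k')
    H) ∧ (∀ w ∈ {w : ℂ × ℂ | |w.2.im| < w.1.re}, ∀ (HF : SchwartzMap (Fin (n + n) → E4) ℂ) (HG :
    SchwartzMap (Fin (m + m) → E4) ℂ), IsAppendTensorOf HF (osAdjoint F) F → IsAppendTensorOf HG
    (osAdjoint G) G → ‖Φ w‖ ^ 2 ≤ ‖S (n + n) (Fin.append (k ∘ Fin.rev) k) HF‖ * ‖S (m + m) (Fin.append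
    (k' ∘ Fin.rev) k') HG‖)

/-- The Step-0 function residual, labelled: every string `𝔖ₙᵏ|⁰𝒮` is a function. -/
def RegL (S : LabelledSchwingerFamily ι E4) : Prop :=
  ∀ (n : ℕ) (k : Fin n → ι), ∃ Wf : (Fin n → E4) → ℂ, ∀ F : SchwartzMap (Fin n → E4) ℂ, IsOffDiagonal F →
    MeasureTheory.Integrable (fun x : Fin n → E4 => Wf x * F x) ∧ S n k F = ∫ x : Fin n → E4, Wf x * F x

/-- Planar-rotation invariance of all strings of degree `N`. -/
def PInvAt (S : LabelledSchwingerFamily ι E4) (N : ℕ) : Prop :=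
  ∀ R : E4 ≃ₗᵢ[ℝ] E4, LinearMap.det (R.toLinearEquiv : E4 →ₗ[ℝ] E4) = 1 → R (EuclideanSpace.single 2 1)
    = EuclideanSpace.single 2 1 → R (EuclideanSpace.single 3 1) = EuclideanSpace.single 3 1 →
    ∀ (k : Fin N → ι) (F : SchwartzMap (Fin N → E4) ℂ), IsOffDiagonal F → S N k (linActMulti R F) = S N k F

/-- The level growth, labelled: at OS level `a`, given invariance in degrees `≤ 2a − 2`, the diagonal
doubled pencils have no layer `|j| ≥ 2`. -/
def GrowL (S : LabelledSchwingerFamily ι E4) : Prop :=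
  ∀ a : ℕ, (∀ N : ℕ, N + 2 ≤ 2 * a → PInvAt S N) →
    ∀ (k : Fin a → ι) (F : SchwartzMap (Fin a → E4) ℂ), IsTimeOrdered F →
    HasCompactSupport (F : (Fin a → E4) → ℂ) → ∀ H : SchwartzMap (Fin (a + a) → E4) ℂ,
    IsAppendTensorOf H (osAdjoint F) F → ∀ (K : ℕ) (p : ℤ → ℂ), (∀ θ : ℝ, S (a + a) (Fin.append (k ∘ Fin.rev) k)
    (linActMulti (planeRot (0 : Fin 3) θ) H) = ∑ j ∈ Finset.Icc (-(K : ℤ)) K, p j * Complex.exp (4 * (j : ℂ)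
    * (θ : ℂ) * Complex.I)) → ∀ j ∈ Finset.Icc (-(K : ℤ)) K, 2 ≤ |j| → p j = 0

/-- The conclusion: planar-rotation invariance of every string. -/
def PInvL (S : LabelledSchwingerFamily ι E4) : Prop :=
  ∀ (R : E4 ≃ₗᵢ[ℝ] E4), LinearMap.det (R.toLinearEquiv : E4 →ₗ[ℝ] E4) = 1 → R (EuclideanSpace.single 2 1)
    = EuclideanSpace.single 2 1 → R (EuclideanSpace.single 3 1) = EuclideanSpace.single 3 1 →
    ∀ (n : ℕ) (k : Fin n → ι) (F : SchwartzMap (Fin n → E4) ℂ), IsOffDiagonal F → S n k (linActMulti R F) = S n k F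

/-- **UNIFORM PLANAR BOOST VECTORS** (the analytic input 4a, universal at `ι`; the statement of
`stub_boostVectorsL`): for every labelled family over `ι` with E0', E3, the eight planar frames and the cone,
every `e₀`-reconstruction `h`, every degree `n` and label string `k`, a TYPE `N` such that every compactly
supported time-ordered `F` has a local holomorphic vector-valued continuation `V` of `θ ↦ Ψ^{k}_{R_θ F}` on a
strip, `‖V θ‖ ≤ C e^{N |Im θ|}`. -/
def BoostVectorsAt (ι : Type) : Prop :=
  ∀ (S : LabelledSchwingerFamily ι E4) (h : OSReconstructionNoE1 S), S.HasLinearGrowth → S.IsSymmetric →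
    Frames8 S → ConeL S → ∀ (n : ℕ) (k : Fin n → ι), ∃ N : ℝ,
      ∀ (F : SchwartzMap (Fin n → E4) ℂ), IsTimeOrdered F → HasCompactSupport (F : (Fin n → E4) → ℂ) →
        ∃ ε : ℝ, 0 < ε ∧ ∃ (V : ℂ → h.Hilbert) (C : ℝ),
          DifferentiableOn ℂ V {θ : ℂ | |θ.re| < ε} ∧
          (∀ θ : ℂ, |θ.re| < ε → ‖V θ‖ ≤ C * Real.exp (N * |θ.im|)) ∧
          ∀ θ : ℝ, |θ| < ε → ∀ hθ : IsTimeOrdered (linActMulti (planeRot (0 : Fin 3) θ) F),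
            V θ = h.fieldVec n k (linActMulti (planeRot (0 : Fin 3) θ) F) hθ

/-- **The crux, unbundled** (definitional). -/
theorem sieve_iff :
    Summit.QuantumFields.QCD.Theses.TransparentRPWall.LabelledBoostSieve ↔
      ∀ (ι : Type) (S : LabelledSchwingerFamily ι E4), S.IsNormalized → S.IsHermitian → S.HasLinearGrowth →
        S.IsReflectionPositive → S.IsSymmetric → S.HasClusterProperty → TransL S → HypL S → Frames8 S →
          ConeL S → RegL S → GrowL S → PInvL S :=
  Iff.rfl

/-! ## The stubs -/

/-- **Stub 0 — THE LABELLED CONE THEOREM** (route item stmt-QuantumFields-9910 `LabelledPlanarSpectralCone` BY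
NAME; DERIVED in the route from `LabelledConeDiscSections` (18618) and `LabelledConeChainDensity` (18619), both
with candidate sorry-free proofs on file — `Cruxes/LabelledPlanarSpectralCone/{Proof.lean, Lines/piece*.lean}`;
difficulty: provable-now, a prover lands the port).  Needed here a SECOND time: the diagonal rays `s < 0` of
`stub_rayPositivityL` use the cone of the 45° pull-backs `S ∘ (R_{π/4} ·)`, eight-frame families not related
to `S` by any available symmetry; the crux's own `ConeL S` serves the axis rays. -/
theorem stub_cone : Summit.QuantumFields.QCD.Theses.TransparentRPWall.LabelledPlanarSpectralCone := by
  sorry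

/-- **Stub 1 — UNIFORM PLANAR BOOST VECTORS, labelled** (THE analytic input 4a of the sibling line, universal
at the label type; model-blind; difficulty XL).  `BoostVectorsAt ι`: with the planar cone `H ≥ |P₁|` of an
`e₀`-reconstruction, the rotation by an imaginary angle `iχ` is the boost `H_χ = cosh χ·H + sinh χ·P₁ ≥ 0`, and
the multi-time OS-II continuation WITHOUT E1 (OS 1975 §IV–V from E0' + E2 + translations) in the
`(x₀,x₁)`-PLANAR tube gives, for compactly supported time-ordered `F` of degree `n` (label string `k`), a vector
`V(θ) = Ψ^{k}_{R_θ F}` holomorphic on a strip `{|Re θ| < ε}` with `‖V θ‖ ≤ C e^{N(S,n)|Im θ|}` (temperedness, OS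
II Ch. VI, gives the type).  In genuine OS theories `N = 0` (boost unitarity) — deliberately NOT assumed.  The
one-species degree-1 case is provable now through sharp one-point vectors + the landed operator cone family
(`…OperatorConeFamily`, p98376; sibling stubs 4a-ii-α/β); degrees `≥ 2` are the sibling's open `stub_
doubledOrbitKernelHigh` (recommended there as a SHARED model-blind item for 9663 / 14999 / 11686 — and now 18043).
Labels only make the slot kernels matrix-valued.  Expected to HOLD on the anisotropic 16-RP Gaussian zoo (finite
type from temperedness) — not a refutation target there. -/
theorem stub_boostVectorsL : ∀ ι : Type, BoostVectorsAt ι := by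
  sorry

/-- **Stub 2 — DOUBLED ORBIT FUNCTIONS ARE TRIGONOMETRIC POLYNOMIALS, labelled** (twin of the LANDED one-species
`stub_orbitBandlimit` / `stub_orbitBandlimitLocal`, `Theorems/MirrorModularBoostsCurvatureBoostCovarianceOrbit
Bandlimit.lean` + `…SoftKernelBoostCovarianceOrbitBandlimitLocal.lean`; difficulty L — a port with label
strings).  For a labelled family with the OS package, translation and proper hypercubic invariance on `⁰𝒮`, the
eight frames, the cone and the function residual, GIVEN the boost vectors of Stub 1 at `ι`, the orbit function
`θ ↦ 𝔖_{n+m}^{rev k ++ k'}(planeRot 0 θ · H)` of every witness `H` of `ΘF* ⊗ G` (`F`, `G` compactly supported,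
`e₀`-time-ordered) is a trigonometric polynomial `Σ_{|j| ≤ K} c_j e^{4ijθ}` (complexify the angle: local
continuation near every real angle from the boost vectors, the quarter turn ∈ `HypL`, gluing to an entire
`π/2`-periodic function of exponential type, the LANDED Paley–Wiener lemma `PencilRigidityNPointIsotropyBandlimit`,
and the residual `RegL` to pass from planar-generic compact supports to all off-diagonal `H` — false without it,
`NPointIsotropy.Negative.Triage3.not_AngularBandLimit`). -/
theorem stub_orbitBandlimitL :
    ∀ (ι : Type), BoostVectorsAt ι → ∀ (S : LabelledSchwingerFamily ι E4), S.IsNormalized → S.IsHermitian →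
      S.HasLinearGrowth → S.IsReflectionPositive → S.IsSymmetric → S.HasClusterProperty → TransL S → HypL S →
      Frames8 S → ConeL S → RegL S →
      ∀ (n m : ℕ) (k : Fin n → ι) (k' : Fin m → ι) (F : SchwartzMap (Fin n → E4) ℂ)
        (G : SchwartzMap (Fin m → E4) ℂ), IsTimeOrdered F → IsTimeOrdered G →
        HasCompactSupport (F : (Fin n → E4) → ℂ) → HasCompactSupport (G : (Fin m → E4) → ℂ) →
        ∀ H : SchwartzMap (Fin (n + m) → E4) ℂ, IsAppendTensorOf H (osAdjoint F) G →
          ∃ (K : ℕ) (c : ℤ → ℂ), ∀ θ : ℝ,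
            S (n + m) (Fin.append (k ∘ Fin.rev) k') (linActMulti (planeRot (0 : Fin 3) θ) H) =
              ∑ j ∈ Finset.Icc (-(K : ℤ)) K, c j * Complex.exp (4 * (j : ℂ) * (θ : ℂ) * Complex.I) := by
  sorry

/-- **Stub 3 — THE LEVER (i): BOOSTS INHERIT THE MIRRORS, labelled** (twin of the LANDED one-species
`stub_rayPositivity` / `stub_rayPositivityLocal` + `stub_rayPositivityCore`; difficulty L — a port).  For a
labelled family with E2, translations, the eight frames and the cone, GIVEN the labelled cone theorem (Stub 0,
for the 45° pull-backs) and the boost vectors of Stub 1 at `ι`: for compactly supported `e₀`-time-ordered `F`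
(labels `k`), `G` (labels `k'`) and witnesses of the four blocks `ΘF*⊗F, ΘF*⊗G, ΘG*⊗F, ΘG*⊗G` whose orbit
functions are trigonometric polynomials with coefficients `p q q' r`, the 2×2 Laurent pencil
`v̄v·P(s) + v̄w·Q(s) + w̄v·Q'(s) + w̄w·R(s)` is real and `≥ 0` for EVERY real `s ≠ 0`: `s = e^{-4χ} > 0` is the
angle `iχ` (Gram form `⟨Ψ^χ_F, Ψ^χ_G⟩` of the boosted vectors of the `e₀`-reconstruction; identity theorem on the
strip at `θ = 0`), `s = -e^{-4χ} < 0` is the angle `π/4 + iχ`, i.e. the orbit function of the 45° pull-back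
`T = 𝔖 ∘ (R_{π/4} ·)`, reflection positive along `e₀` by `Frames8` at the frame `R_{π/4}` (axis `(e₀−e₁)/√2`),
translation invariant, E0'/E3 transported, eight-frame (`R_{π/4}` permutes the eight axes) and hence coned by
Stub 0 — the diagonal mirrors at work.  Labels ride along: each block carries its own label string. -/
theorem stub_rayPositivityL :
    ∀ (ι : Type), Summit.QuantumFields.QCD.Theses.TransparentRPWall.LabelledPlanarSpectralCone →
      BoostVectorsAt ι → ∀ (S : LabelledSchwingerFamily ι E4), S.HasLinearGrowth → S.IsReflectionPositive →
      S.IsSymmetric → TransL S → Frames8 S → ConeL S →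
      ∀ (n m : ℕ) (k : Fin n → ι) (k' : Fin m → ι) (F : SchwartzMap (Fin n → E4) ℂ)
        (G : SchwartzMap (Fin m → E4) ℂ), IsTimeOrdered F → IsTimeOrdered G →
        HasCompactSupport (F : (Fin n → E4) → ℂ) → HasCompactSupport (G : (Fin m → E4) → ℂ) →
        ∀ (HFF : SchwartzMap (Fin (n + n) → E4) ℂ) (HFG : SchwartzMap (Fin (n + m) → E4) ℂ)
          (HGF : SchwartzMap (Fin (m + n) → E4) ℂ) (HGG : SchwartzMap (Fin (m + m) → E4) ℂ),
          IsAppendTensorOf HFF (osAdjoint F) F → IsAppendTensorOf HFG (osAdjoint F) G →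
          IsAppendTensorOf HGF (osAdjoint G) F → IsAppendTensorOf HGG (osAdjoint G) G →
        ∀ (Kp Kq Kq' Kr : ℕ) (p q q' r : ℤ → ℂ),
          (∀ θ : ℝ, S (n + n) (Fin.append (k ∘ Fin.rev) k) (linActMulti (planeRot (0 : Fin 3) θ) HFF) =
            ∑ j ∈ Finset.Icc (-(Kp : ℤ)) Kp, p j * Complex.exp (4 * (j : ℂ) * (θ : ℂ) * Complex.I)) →
          (∀ θ : ℝ, S (n + m) (Fin.append (k ∘ Fin.rev) k') (linActMulti (planeRot (0 : Fin 3) θ) HFG) =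
            ∑ j ∈ Finset.Icc (-(Kq : ℤ)) Kq, q j * Complex.exp (4 * (j : ℂ) * (θ : ℂ) * Complex.I)) →
          (∀ θ : ℝ, S (m + n) (Fin.append (k' ∘ Fin.rev) k) (linActMulti (planeRot (0 : Fin 3) θ) HGF) =
            ∑ j ∈ Finset.Icc (-(Kq' : ℤ)) Kq', q' j * Complex.exp (4 * (j : ℂ) * (θ : ℂ) * Complex.I)) →
          (∀ θ : ℝ, S (m + m) (Fin.append (k' ∘ Fin.rev) k') (linActMulti (planeRot (0 : Fin 3) θ) HGG) =
            ∑ j ∈ Finset.Icc (-(Kr : ℤ)) Kr, r j * Complex.exp (4 * (j : ℂ) * (θ : ℂ) * Complex.I)) →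
        ∀ s : ℝ, s ≠ 0 → ∀ v w : ℂ,
          (fun z : ℂ => 0 ≤ z.re ∧ z.im = 0)
            ((∑ j ∈ Finset.Icc (-(Kp : ℤ)) Kp, starRingEnd ℂ v * v * (p j * (s : ℂ) ^ j)) +
            (∑ j ∈ Finset.Icc (-(Kq : ℤ)) Kq, starRingEnd ℂ v * w * (q j * (s : ℂ) ^ j)) +
            (∑ j ∈ Finset.Icc (-(Kq' : ℤ)) Kq', starRingEnd ℂ w * v * (q' j * (s : ℂ) ^ j)) +
            (∑ j ∈ Finset.Icc (-(Kr : ℤ)) Kr, starRingEnd ℂ w * w * (r j * (s : ℂ) ^ j))) := by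
  sorry

/-- **Stub 4 — DOUBLED-ORBIT CONSTANCY ⇒ INVARIANCE, labelled** (twin of the LANDED one-species
`stub_doubledToInvariant` + `stub_tensorDensity`, `Theorems/MirrorModularBoostsCurvatureBoostCovariance
DoubledToInvariant.lean` / `…TensorDensity.lean`; difficulty M–L — a port).  E3 + translations + the residual:
if every doubled orbit function with `deg F, deg G ≤ b` (all label strings) is constant in the angle, then every
string of degree `N ≤ 2b` is planar-invariant on `⁰𝒮` (`R = planeRot 0 φ` by the landed
`Mopup.exists_eq_planeRot`; balanced cut `N = n + m`; products of `C_c^∞` functions on the negative/positive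
ordered chambers are witnesses and determine the representing function a.e. on the cut chamber — du
Bois-Reymond for appended tensors; E3 (the label string travels with the permutation) and rational time shifts
spread it to the open conull set of pairwise-distinct times; conclude with the landed a.e. change of variables
`Mopup.apply_linActMulti_eq_of_generic`).  False without the residual (`PlanarGenericJunk`). -/
theorem stub_doubledToInvariantL :
    ∀ (ι : Type) (S : LabelledSchwingerFamily ι E4), S.IsSymmetric → TransL S → RegL S →
      ∀ b : ℕ,
        (∀ n m : ℕ, n ≤ b → m ≤ b →
          ∀ (k : Fin n → ι) (k' : Fin m → ι) (F : SchwartzMap (Fin n → E4) ℂ) (G : SchwartzMap (Fin m → E4) ℂ),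
            IsTimeOrdered F → IsTimeOrdered G →
            HasCompactSupport (F : (Fin n → E4) → ℂ) → HasCompactSupport (G : (Fin m → E4) → ℂ) →
            ∀ H : SchwartzMap (Fin (n + m) → E4) ℂ, IsAppendTensorOf H (osAdjoint F) G →
              ∀ θ : ℝ, S (n + m) (Fin.append (k ∘ Fin.rev) k') (linActMulti (planeRot (0 : Fin 3) θ) H) =
                S (n + m) (Fin.append (k ∘ Fin.rev) k') H) →
        ∀ N : ℕ, N ≤ 2 * b → PInvAt S N := by
  sorry

/-! ## Checks against the landed knowledge (imports live; sorry-free) -/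

/-- The parity sieve — the lever (ii) — is LANDED and label-free (the four blocks are scalars whatever the
label strings): `BoostsInheritMirrors.stub_paritySieve`. -/
theorem paritySieve :
    ∀ (Kp Kq Kq' Kr : ℕ) (p q q' r : ℤ → ℂ),
      (∀ s : ℝ, s ≠ 0 → ∀ v w : ℂ,
        (fun z : ℂ => 0 ≤ z.re ∧ z.im = 0)
          ((∑ k ∈ Finset.Icc (-(Kp : ℤ)) Kp, starRingEnd ℂ v * v * (p k * (s : ℂ) ^ k)) +
          (∑ k ∈ Finset.Icc (-(Kq : ℤ)) Kq, starRingEnd ℂ v * w * (q k * (s : ℂ) ^ k)) +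
          (∑ k ∈ Finset.Icc (-(Kq' : ℤ)) Kq', starRingEnd ℂ w * v * (q' k * (s : ℂ) ^ k)) +
          (∑ k ∈ Finset.Icc (-(Kr : ℤ)) Kr, starRingEnd ℂ w * w * (r k * (s : ℂ) ^ k)))) →
      (∀ k ∈ Finset.Icc (-(Kp : ℤ)) Kp, 2 ≤ |k| → p k = 0) →
      (∀ k ∈ Finset.Icc (-(Kr : ℤ)) Kr, 2 ≤ |k| → r k = 0) →
      ∀ k ∈ Finset.Icc (-(Kq : ℤ)) Kq, k ≠ 0 → q k = 0 :=
  Summit.QuantumFields.YangMills.Theorems.CurvatureBoostCovariance.BoostsInheritMirrors.stub_paritySieve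

/-! ## Composition (pure logic): strong induction on the OS level -/

/-- The rotation by the angle `0` acts trivially on test functions. -/
theorem linActMulti_planeRot_zero {n : ℕ} (H : 𝓢((Fin n → E4), ℂ)) :
    linActMulti (planeRot (0 : Fin 3) 0) H = H := by
  ext x
  rw [linActMulti_apply]
  congr 1
  funext i
  exact (planeRot (0 : Fin 3) 0).injective (by rw [LinearIsometryEquiv.apply_symm_apply, planeRot_zero_apply])

/-- **The skeleton**: the five stubs and the landed parity sieve prove `TransparentRPWall.LabelledBoostSieve`
(concluded BY NAME; the only sorries are the stubs).  Proof = the sibling's `sieve_of_stubs` with label strings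
threaded: by induction on the level `a`, every doubled orbit function with `deg F, deg G ≤ a` is constant — the
induction hypothesis and Stub 4 give invariance in degrees `≤ 2a − 2`, the level growth kills the layers `|j| ≥ 2`
of the two diagonal blocks, Stub 3 gives positivity of the 2×2 pencil on `ℝ∖0`, the parity sieve makes the
`(F,G)` block constant; then Stub 4 at level `N` gives degree `N`. -/
theorem LabelledBoostSieve_of : Summit.QuantumFields.QCD.Theses.TransparentRPWall.LabelledBoostSieve := by
  rw [sieve_iff]
  intro ι S hnorm hherm hlg hrp hsym hclus htr hhyp h8 hC hreg hgrow
  have hbv : BoostVectorsAt ι := stub_boostVectorsL ι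
  have hband := stub_orbitBandlimitL ι hbv S hnorm hherm hlg hrp hsym hclus htr hhyp h8 hC hreg
  have hpos := stub_rayPositivityL ι stub_cone hbv S hlg hrp hsym htr h8 hC
  have hd2i := stub_doubledToInvariantL ι S hsym htr hreg
  -- one level of the induction: invariance below `2a - 1` ⇒ doubled-orbit constancy up to level `a`
  have level_step : ∀ a : ℕ, (∀ N : ℕ, N + 2 ≤ 2 * a → PInvAt S N) →
      ∀ n m : ℕ, n ≤ a → m ≤ a →
        ∀ (k : Fin n → ι) (k' : Fin m → ι) (F : 𝓢((Fin n → E4), ℂ)) (G : 𝓢((Fin m → E4), ℂ)),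
          IsTimeOrdered F → IsTimeOrdered G →
          HasCompactSupport (F : (Fin n → E4) → ℂ) → HasCompactSupport (G : (Fin m → E4) → ℂ) →
          ∀ H : 𝓢((Fin (n + m) → E4), ℂ), IsAppendTensorOf H (osAdjoint F) G →
            ∀ θ : ℝ, S (n + m) (Fin.append (k ∘ Fin.rev) k') (linActMulti (planeRot (0 : Fin 3) θ) H) =
              S (n + m) (Fin.append (k ∘ Fin.rev) k') H := by
    intro a hInv n m hn hm k k' F G hF hG hFc hGc H hH θ
    -- the four doubled blocks and their trigonometric data (Stub 2)
    obtain ⟨HFF, hHFF⟩ := exists_isAppendTensorOf (osAdjoint F) F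
    obtain ⟨HGF, hHGF⟩ := exists_isAppendTensorOf (osAdjoint G) F
    obtain ⟨HGG, hHGG⟩ := exists_isAppendTensorOf (osAdjoint G) G
    obtain ⟨Kp, p, hp⟩ := hband n n k k F F hF hF hFc hFc HFF hHFF
    obtain ⟨Kq, q, hq⟩ := hband n m k k' F G hF hG hFc hGc H hH
    obtain ⟨Kq', q', hq'⟩ := hband m n k' k G F hG hF hGc hFc HGF hHGF
    obtain ⟨Kr, r, hr⟩ := hband m m k' k' G G hG hG hGc hGc HGG hHGG
    -- boosts inherit the mirrors (Stub 3): the pencil is PSD on both half-lines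
    have hpsd := hpos n m k k' F G hF hG hFc hGc HFF H HGF HGG hHFF hH hHGF hHGG Kp Kq Kq' Kr p q q' r
      hp hq hq' hr
    -- level growth at the levels `n` and `m`: no diagonal layer `|j| ≥ 2`
    have hp2 : ∀ j ∈ Finset.Icc (-(Kp : ℤ)) Kp, 2 ≤ |j| → p j = 0 :=
      hgrow n (fun N hN => hInv N (by omega)) k F hF hFc HFF hHFF Kp p hp
    have hr2 : ∀ j ∈ Finset.Icc (-(Kr : ℤ)) Kr, 2 ≤ |j| → r j = 0 :=
      hgrow m (fun N hN => hInv N (by omega)) k' G hG hGc HGG hHGG Kr r hr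
    -- parity + Cauchy–Schwarz (the landed sieve): the `(F,G)` block is constant
    have hq0 : ∀ j ∈ Finset.Icc (-(Kq : ℤ)) Kq, j ≠ 0 → q j = 0 :=
      paritySieve Kp Kq Kq' Kr p q q' r hpsd hp2 hr2
    calc S (n + m) (Fin.append (k ∘ Fin.rev) k') (linActMulti (planeRot (0 : Fin 3) θ) H)
        = ∑ j ∈ Finset.Icc (-(Kq : ℤ)) Kq, q j * Complex.exp (4 * (j : ℂ) * (θ : ℂ) * Complex.I) := hq θ
      _ = ∑ j ∈ Finset.Icc (-(Kq : ℤ)) Kq,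
            q j * Complex.exp (4 * (j : ℂ) * ((0 : ℝ) : ℂ) * Complex.I) := by
          refine Finset.sum_congr rfl fun j hj => ?_
          by_cases hj0 : j = 0
          · subst hj0; simp
          · rw [hq0 j hj hj0]; simp
      _ = S (n + m) (Fin.append (k ∘ Fin.rev) k') (linActMulti (planeRot (0 : Fin 3) 0) H) := (hq 0).symm
      _ = S (n + m) (Fin.append (k ∘ Fin.rev) k') H := by rw [linActMulti_planeRot_zero]
  -- the induction on the level
  have hQ : ∀ a n m : ℕ, n ≤ a → m ≤ a →
      ∀ (k : Fin n → ι) (k' : Fin m → ι) (F : 𝓢((Fin n → E4), ℂ)) (G : 𝓢((Fin m → E4), ℂ)),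
        IsTimeOrdered F → IsTimeOrdered G →
        HasCompactSupport (F : (Fin n → E4) → ℂ) → HasCompactSupport (G : (Fin m → E4) → ℂ) →
        ∀ H : 𝓢((Fin (n + m) → E4), ℂ), IsAppendTensorOf H (osAdjoint F) G →
          ∀ θ : ℝ, S (n + m) (Fin.append (k ∘ Fin.rev) k') (linActMulti (planeRot (0 : Fin 3) θ) H) =
            S (n + m) (Fin.append (k ∘ Fin.rev) k') H := by
    intro a
    induction a with
    | zero => exact level_step 0 fun N hN => absurd hN (by omega)
    | succ a ih => exact level_step (a + 1) fun N hN => hd2i a ih N (by omega)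
  -- every degree
  intro R hdet h2 h3 N k F hF
  exact hd2i N (hQ N) N (by omega) R hdet h2 h3 k F hF

end Summit.QuantumFields.QCD.Cruxes.LabelledBoostSieve.Birth

end
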